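import Literature.NumberTheory.Automorphic.AlgebraicWeightFinitenessOfGLIntegers
import HarnessLib

/-!
# `algebraicWeightEigenclass_continuousPoint` from "the cohomology of `GL_n(𝓞_K)` is of finite type"

Topic `NumberTheory/Automorphic`; namespace `Literature.NumberTheory.Automorphic.AlgebraicWeight`.
Theorems only; no named fact, no instance, no `sorry`.  Companion of
`AlgebraicWeightFinitenessOfGLIntegers`, isolating the MINIMAL interface through which the
Borel–Serre finiteness enters [Scholze2015, Thm. V.4.1 / Cor. V.4.2] in the tree: not a
resolution, but the two consequences (F) "`Hⁿ(Γ, A)` finitely generated for `A` finitely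
generated" and (U) "`Hⁿ(Γ, -)` commutes with directed unions", up to a positive multiplier, for
the single group `Γ = GL_n(𝓞_K)` — `IsCohFiniteTypeUpTo k (GL (Fin n) (𝓞 K)) m`
(`GroupCohomologyFiniteType`), which is stable under commensurability and needs no
torsion-freeness:

* `algebraicWeightEigenclass_continuousPoint_of_isCohFiniteTypeUpTo` — the named fact from
  `hcoh : ∀ n K k, ∃ m > 0, IsCohFiniteTypeUpTo k (GL (Fin n) (𝓞 K)) m`;
* `exists_isCohFiniteTypeUpTo_glIntegers_of_resolution` — `hcoh` from a subgroup of finite index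
  of type `FP_∞` over `ℤ` (so `…_of_glIntegers` is a corollary), i.e. from [BorelSerre1973,
  §11.1 (c), Thm. 11.4.4] — composing it with `…_of_isCohFiniteTypeUpTo` re-proves the landed
  `…_of_glIntegers`; `hcoh` equally follows from any `Γ`-equivariant acyclic cover / cell
  structure argument on the symmetric space with finitely many orbits and free index sets (Čech
  co-resolutions), torsion allowed — the form pursued for `n = 2` in the tree's Bianchi cruxes.

## References

* P. Scholze, Ann. of Math. 182 (2015), §V.4, Thm. V.4.1, Cor. V.4.2. [Scholze2015]
* A. Borel, J.-P. Serre, Comment. Math. Helv. 48 (1973), §11.1 (c), Thm. 11.4.4. [BorelSerre1973]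
* K. S. Brown, *Cohomology of Groups*, GTM 87 (1982), VIII (4.6), (5.1); VII §4–§7
  (equivariant covers and complexes). [Brown1982CohomologyGroups]
-/

noncomputable section

open CategoryTheory
open IsDedekindDomain NumberField
open Literature.Algebra.Homology
open Literature.NumberTheory.Automorphic.BigHeckeGLn Literature.NumberTheory.Automorphic.TwistedQuotient

namespace Literature.NumberTheory.Automorphic

namespace AlgebraicWeight

/-! ### From `GL_n(𝓞_K)` to the commensurable subgroups of `GL_n(K)` -/

/-- **Finite type passes from `GL_n(𝓞_K)` to every subgroup of `GL_n(K)` commensurable with its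
image** (transport along `GL_n(𝓞_K) ≃ im`, then commensurability; the multiplier stays positive).
[cite: Brown1982CohomologyGroups, VIII (5.1)] -/
theorem exists_isCohFiniteTypeUpTo_of_commensurable_glIntegers (K : Type) [Field K]
    [NumberField K] (n : ℕ) (k : Type) [CommRing k]
    (hcoh : ∃ m : ℕ, 0 < m ∧ IsCohFiniteTypeUpTo k (GL (Fin n) (𝓞 K)) m)
    (Γx : Subgroup (GL (Fin n) K))
    (hc : Γx.Commensurable (Matrix.GeneralLinearGroup.map (algebraMap (𝓞 K) K) :
      GL (Fin n) (𝓞 K) →* GL (Fin n) K).range) :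
    ∃ m : ℕ, 0 < m ∧ IsCohFiniteTypeUpTo k Γx m := by
  obtain ⟨m, hm, h₂⟩ := hcoh
  have h₃ : IsCohFiniteTypeUpTo k (Matrix.GeneralLinearGroup.map (algebraMap (𝓞 K) K) :
      GL (Fin n) (𝓞 K) →* GL (Fin n) K).range m :=
    IsCohFiniteTypeUpTo.of_mulEquiv
      (MonoidHom.ofInjective (map_algebraMap_ringOfIntegers_injective n K)) h₂
  haveI : (Γx.subgroupOf (Matrix.GeneralLinearGroup.map (algebraMap (𝓞 K) K) :
      GL (Fin n) (𝓞 K) →* GL (Fin n) K).range).FiniteIndex := ⟨hc.1⟩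
  haveI : ((Matrix.GeneralLinearGroup.map (algebraMap (𝓞 K) K) :
      GL (Fin n) (𝓞 K) →* GL (Fin n) K).range.subgroupOf Γx).FiniteIndex := ⟨hc.2⟩
  exact ⟨m * ((Matrix.GeneralLinearGroup.map (algebraMap (𝓞 K) K) :
      GL (Fin n) (𝓞 K) →* GL (Fin n) K).range.subgroupOf Γx).index,
    Nat.mul_pos hm (Nat.pos_of_ne_zero Subgroup.FiniteIndex.index_ne_zero),
    IsCohFiniteTypeUpTo.of_commensurable (Γ := Γx) (h₀ := h₃)⟩

/-- **`hcoh` from a subgroup of finite index of type `FP_∞` over `ℤ`** ([BorelSerre1973,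
§11.1 (c), Thm. 11.4.4]): multiplier `[GL_n(𝓞_K) : Γ']`. [cite: BorelSerre1973, §11.1 (c), Thm. 11.4.4]
[cite: Brown1982CohomologyGroups, VIII (5.1), III (9.5)] -/
theorem exists_isCohFiniteTypeUpTo_glIntegers_of_resolution (K : Type) [Field K] [NumberField K]
    (n : ℕ) (k : Type) [CommRing k] (Γ' : Subgroup (GL (Fin n) (𝓞 K))) [Γ'.FiniteIndex]
    (P : ProjectiveResolution (Rep.trivial ℤ Γ' ℤ))
    (hP : ∀ i, ∃ m : ℕ, Nonempty (P.complex.X i ≅ Rep.free ℤ Γ' (Fin m))) :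
    ∃ m : ℕ, 0 < m ∧ IsCohFiniteTypeUpTo k (GL (Fin n) (𝓞 K)) m :=
  ⟨1 * Γ'.index, by
    rw [one_mul]
    exact Nat.pos_of_ne_zero Subgroup.FiniteIndex.index_ne_zero,
    IsCohFiniteTypeUpTo.of_subgroup (S := Γ') (isCohFiniteTypeUpTo_one_of_int_resolution P hP)⟩

variable (K : Type) [Field K] [NumberField K] (n p : ℕ) [Fact p.Prime]
  (lam : (K →+* PadicAlgCl p) → Fin n → ℤ)

/-! ### HX and HU from `hcoh` -/

/-- **`H^q(Γ, indFun M_S)` is a finitely generated `ℤ_p`-module, granted `hcoh`.**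
[cite: Scholze2015, §V.4 (proof of Thm. V.4.1)] -/
theorem moduleFinite_cohomology_indFun_stageLattice_of_isCohFiniteTypeUpTo
    (hcoh : ∀ (n : ℕ) (K : Type) [Field K] [NumberField K] (k : Type) [CommRing k],
      ∃ m : ℕ, 0 < m ∧ IsCohFiniteTypeUpTo k (GL (Fin n) (𝓞 K)) m)
    (𝒰 : TameLevel n K p) {S : Finset (PadicAlgCl p)} (hS : ∀ c ∈ S, ‖c‖ ≤ 1) (q : ℕ) :
    Module.Finite ℤ_[p] (groupCohomology (indFun (globalEmbedding n K) 𝒰.subgroup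
      (latticeRep 𝒰.subgroup (padicIntRep K n p lam) (stageLattice K n p lam S)
        (stageLattice_stable K n p lam 𝒰 S))) q) := by
  obtain ⟨s, -, hcov⟩ := exists_orbit_representatives K n p 𝒰
  refine moduleFinite_cohomology_indFun_of_finite_cover (globalEmbedding n K) 𝒰.subgroup _ s hcov q
    fun x _ => ?_
  haveI : Module.Finite ℤ_[p] (indStabilizerRep (globalEmbedding n K) 𝒰.subgroup
      (latticeRep 𝒰.subgroup (padicIntRep K n p lam) (stageLattice K n p lam S)
        (stageLattice_stable K n p lam 𝒰 S)) x) :=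
    moduleFinite_stageLattice K n p lam hS
  obtain ⟨m, -, hft⟩ := exists_isCohFiniteTypeUpTo_of_commensurable_glIntegers K n ℤ_[p]
    (hcoh n K ℤ_[p]) _ (commensurable_orbitStabilizer_glIntegers 𝒰.subgroup 𝒰.isOpen 𝒰.isCompact
      (x : FiniteAdelicGL n K ⧸ 𝒰.subgroup))
  exact hft.moduleFinite _ q

/-- Per orbit: the stage system seen by `Γ_x`, granted `hcoh`. [cite: Scholze2015, §V.4 (proof of Thm. V.4.1)] -/
theorem exists_map_indStabMap_eq_nsmul_of_isCohFiniteTypeUpTo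
    (hcoh : ∀ (n : ℕ) (K : Type) [Field K] [NumberField K] (k : Type) [CommRing k],
      ∃ m : ℕ, 0 < m ∧ IsCohFiniteTypeUpTo k (GL (Fin n) (𝓞 K)) m)
    (𝒰 : TameLevel n K p) (x : FiniteAdelicGL n K) (q : ℕ) :
    ∃ m : ℕ, 0 < m ∧ ∀ z : groupCohomology (indStabilizerRep (globalEmbedding n K) 𝒰.subgroup
      (latticeRep 𝒰.subgroup (padicIntRep K n p lam) ⊤ (top_stable' K n p lam 𝒰.subgroup)) x) q,
      ∃ (i : StageIndex p) (y : groupCohomology (indStabilizerRep (globalEmbedding n K) 𝒰.subgroup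
        (stageDivRep K n p lam 𝒰 i) x) q),
        groupCohomology.map (MonoidHom.id _) (indStabMap (globalEmbedding n K) 𝒰.subgroup
          (stageDivRep K n p lam 𝒰 i) _ x (stageDivIncl K n p lam 𝒰 i)) q y = m • z := by
  haveI : IsDirected (StageIndex p) (· ≤ ·) := stageIndex_isDirected p
  haveI : Nonempty (StageIndex p) := ⟨(⟨∅, fun c hc => absurd hc (Finset.notMem_empty c)⟩, 0)⟩
  obtain ⟨m, hm, hft⟩ := exists_isCohFiniteTypeUpTo_of_commensurable_glIntegers K n ℤ_[p]
    (hcoh n K ℤ_[p]) _ (commensurable_orbitStabilizer_glIntegers 𝒰.subgroup 𝒰.isOpen 𝒰.isCompact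
      (x : FiniteAdelicGL n K ⧸ 𝒰.subgroup))
  let D : DirectedSubrepSystem ℤ_[p]
      (orbitStabilizer (globalEmbedding n K) 𝒰.subgroup (x : FiniteAdelicGL n K ⧸ 𝒰.subgroup)) :=
    { ι := StageIndex p
      A := fun i => indStabilizerRep (globalEmbedding n K) 𝒰.subgroup (stageDivRep K n p lam 𝒰 i) x
      B := indStabilizerRep (globalEmbedding n K) 𝒰.subgroup
        (latticeRep 𝒰.subgroup (padicIntRep K n p lam) ⊤ (top_stable' K n p lam 𝒰.subgroup)) x
      φ := fun i => indStabMap (globalEmbedding n K) 𝒰.subgroup (stageDivRep K n p lam 𝒰 i) _ x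
        (stageDivIncl K n p lam 𝒰 i)
      injective := fun i => indStabMap_injective (globalEmbedding n K) 𝒰.subgroup
        (stageDivRep K n p lam 𝒰 i) _ x (stageDivIncl K n p lam 𝒰 i)
        (stageDivIncl_injective K n p lam 𝒰 i)
      t := fun _ _ hij => indStabMap (globalEmbedding n K) 𝒰.subgroup (stageDivRep K n p lam 𝒰 _)
        (stageDivRep K n p lam 𝒰 _) x (stageDivTrans K n p lam 𝒰 hij)
      t_comp := fun _ _ hij => Rep.hom_ext (Representation.IntertwiningMap.ext (LinearMap.ext
        fun v => stageDivIncl_stageDivTrans K n p lam 𝒰 hij v))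
      exhaust := fun v => by
        obtain ⟨i, w, hw⟩ := stageDiv_cover K n p lam 𝒰 v
        exact ⟨i, w, hw⟩ }
  exact ⟨m, hm, fun z => hft.exists_map_eq D q z⟩

/-- **Every class of `H^q(Γ, indFun V)` has a `p`-power multiple in the image of some
`H^q(Γ, indFun M_S)`, granted `hcoh`** (the hypothesis `HU` of
`algebraicWeightEigenclass_continuousPoint_of_finiteness`; orbit gluing, then the `p`-adic unit
correction of `exists_stage_of_glIntegers`). [cite: Scholze2015, §V.4 (proof of Thm. V.4.1)] -/
theorem exists_stage_of_isCohFiniteTypeUpTo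
    (hcoh : ∀ (n : ℕ) (K : Type) [Field K] [NumberField K] (k : Type) [CommRing k],
      ∃ m : ℕ, 0 < m ∧ IsCohFiniteTypeUpTo k (GL (Fin n) (𝓞 K)) m)
    (𝒰 : TameLevel n K p) (q : ℕ)
    (y : groupCohomology (indFun (globalEmbedding n K) 𝒰.subgroup
      (latticeRep 𝒰.subgroup (padicIntRep K n p lam) ⊤ (top_stable' K n p lam 𝒰.subgroup))) q) :
    ∃ S : Finset (PadicAlgCl p), (∀ c ∈ S, ‖c‖ ≤ 1) ∧ ∃ (c : ℕ)
      (z : groupCohomology (indFun (globalEmbedding n K) 𝒰.subgroup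
        (latticeRep 𝒰.subgroup (padicIntRep K n p lam) (stageLattice K n p lam S)
          (stageLattice_stable K n p lam 𝒰 S))) q),
      ((groupCohomology.functor ℤ_[p] (GL (Fin n) K) q).map
        (indInclTop K n p lam 𝒰.subgroup (stageLattice K n p lam S)
          (stageLattice_stable K n p lam 𝒰 S))).hom z = (((p ^ c : ℕ) : ℤ_[p])) • y := by
  have hp : p.Prime := Fact.out
  haveI : IsDirected (StageIndex p) (· ≤ ·) := stageIndex_isDirected p
  haveI : Nonempty (StageIndex p) := ⟨(⟨∅, fun c hc => absurd hc (Finset.notMem_empty c)⟩, 0)⟩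
  -- orbit gluing, multiple `N = ∏ m_x ≥ 1`
  obtain ⟨s, hdisj, hcov⟩ := exists_orbit_representatives K n p 𝒰
  choose m hm0 hm using fun x : FiniteAdelicGL n K =>
    exists_map_indStabMap_eq_nsmul_of_isCohFiniteTypeUpTo K n p lam hcoh 𝒰 x q
  have hN : 0 < ∏ x ∈ s, m x := Finset.prod_pos fun x _ => hm0 x
  obtain ⟨i, y', hy'⟩ := exists_map_indFunMap_eq_prod_nsmul_of_orbits (globalEmbedding n K)
    𝒰.subgroup (latticeRep 𝒰.subgroup (padicIntRep K n p lam) ⊤ (top_stable' K n p lam 𝒰.subgroup))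
    (stageDivRep K n p lam 𝒰) (stageDivIncl K n p lam 𝒰) (stageDivTrans K n p lam 𝒰)
    (stageDivIncl_stageDivTrans K n p lam 𝒰) s hdisj hcov m q (fun x _ z => hm x z) y
  -- `N = p^a u` with `p ∤ u`, and `u` is a unit of `ℤ_p`
  obtain ⟨a, u, hu, hNeq⟩ := Nat.exists_eq_pow_mul_and_not_dvd hN.ne' p hp.one_lt.ne'
  have hunit : IsUnit (u : ℤ_[p]) := by
    rw [PadicInt.isUnit_iff]
    exact le_antisymm (PadicInt.norm_le_one _)
      (not_lt.1 fun hlt => hu (PadicInt.norm_natCast_lt_one_iff.1 hlt))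
  obtain ⟨uu, huu⟩ := hunit
  have hy'' : groupCohomology.map (MonoidHom.id _) (indFunMap (globalEmbedding n K) 𝒰.subgroup
      (stageDivRep K n p lam 𝒰 i) _ (stageDivIncl K n p lam 𝒰 i)) q ((↑uu⁻¹ : ℤ_[p]) • y') =
        (((p ^ a : ℕ) : ℤ_[p])) • y := by
    rw [map_smul, hy', ← Nat.cast_smul_eq_nsmul ℤ_[p], hNeq, Nat.cast_mul, ← huu, smul_smul,
      mul_comm (((p ^ a : ℕ) : ℤ_[p])), ← mul_assoc, Units.inv_mul, one_mul]
  -- `p^{-t} M_S ≅ M_S` by `p^t`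
  obtain ⟨z, hz⟩ := exists_of_map_indFunMap_divLattice (globalEmbedding n K) 𝒰.subgroup
    (padicIntRep K n p lam) (stageLattice K n p lam i.1.1) (stageLattice_stable K n p lam 𝒰 i.1.1)
    (p ^ i.2) (top_stable' K n p lam 𝒰.subgroup) le_top le_top q _ _ hy''
  refine ⟨i.1.1, i.1.2, i.2 + a, z, ?_⟩
  rw [pow_add, Nat.cast_mul, mul_smul, Nat.cast_smul_eq_nsmul ℤ_[p] (p ^ i.2)]
  exact hz

/-! ### The named fact from `hcoh` -/

/-- **`algebraicWeightEigenclass_continuousPoint` from "the cohomology of `GL_n(𝓞_K)` is of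
finite type up to a positive multiplier, over every commutative ring"** — the minimal form of
the Borel–Serre input to [Scholze2015, Thm. V.4.1 / Cor. V.4.2] in the tree (implied by
[BorelSerre1973, §11.1 (c), Thm. 11.4.4] via `exists_isCohFiniteTypeUpTo_glIntegers_of_resolution`,
and by any equivariant acyclic-cover argument with finitely many orbits, torsion allowed).
[cite: Scholze2015, Thm. V.4.1 and Cor. V.4.2] [cite: BorelSerre1973, §11.1 (c), Thm. 11.4.4] -/
theorem algebraicWeightEigenclass_continuousPoint_of_isCohFiniteTypeUpTo
    (hcoh : ∀ (n : ℕ) (K : Type) [Field K] [NumberField K] (k : Type) [CommRing k],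
      ∃ m : ℕ, 0 < m ∧ IsCohFiniteTypeUpTo k (GL (Fin n) (𝓞 K)) m) :
    algebraicWeightEigenclass_continuousPoint :=
  algebraicWeightEigenclass_continuousPoint_of_finiteness
    (fun K _ _ n p _ lam 𝒰 _ hS q =>
      moduleFinite_cohomology_indFun_stageLattice_of_isCohFiniteTypeUpTo K n p lam hcoh 𝒰 hS q)
    (fun K _ _ n p _ lam 𝒰 q y => exists_stage_of_isCohFiniteTypeUpTo K n p lam hcoh 𝒰 q y)

end AlgebraicWeight

end Literature.NumberTheory.Automorphic
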